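import Mathlib.Analysis.Normed.Field.Lemmas
import Mathlib.Analysis.Normed.Group.Bounded
import Literature.AlgebraicTopology.CharacteristicClasses.ComplexVectorBundle
import Literature.AlgebraicTopology.CharacteristicClasses.FibrewiseContinuity
import Literature.AlgebraicTopology.CharacteristicClasses.TautologicalLineCore
import HarnessLib

/-!
# The tautological bundle over `ℙ ℂ V` as a complex vector bundle, and projective lines in it

Topic `Literature/AlgebraicTopology/CharacteristicClasses`. Three assembly steps towards the
classifying datum of the uniqueness theorem for Chern classes
(`TopologicalChernClassesUniqueness`: a space `P` with a line bundle `γ` and a map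
`ι : ℂP¹ → P` with `ι*γ ≅ γ¹`):

* `tautologicalBundle V : ComplexVectorBundle (ℙ ℂ V)` — the tautological line bundle of
  `TautologicalLineCore` (`tautologicalLineCore ℂ V`, cocycle presentation) bundled, of rank `1`;
* `ComplexVectorBundle.isoPullbackOfCoreMorph` — a morphism of cores `(f, j) : Z₁ → Z₂`
  (compatible charts and cocycles, `FibrewiseContinuity`) gives a `B`-isomorphism
  `Z₁ ≅ f* Z₂` of the bundled complex vector bundles (Husemoller, Ch. 5 §3 with Ch. 3 §3: an
  `f`-morphism which is an isomorphism on fibres factors through an isomorphism with the induced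
  bundle, Ch. 3 Prop. 3.2 / Ch. 2 Prop. 5.5);
* `projectiveLine e₀ e₁ φ₀ φ₁ : C(OnePoint ℂ, ℙ ℂ V)` — the projective line through `[e₀]`,
  `[e₁]`: `t ↦ [t e₀ + e₁]`, `∞ ↦ [e₀]` (the tree's model `ℂP¹ = OnePoint ℂ`, `t ↔ [t : 1]`,
  `∞ ↔ [1 : 0]`, `ComplexVectorBundle`), for vectors `e₀, e₁` with dual functionals `φ₀, φ₁`
  (`φᵢ eⱼ = δᵢⱼ`), and **`tautologicalLineBundleIsoPullback`**: the tree's `γ¹ =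
  tautologicalLineBundle` over `OnePoint ℂ` is isomorphic to the pull-back of `tautologicalBundle V`
  along this line — the chart `finite` of `γ¹` is the chart `U_{φ₁}` and `infinite` is `U_{φ₀}`,
  and the cocycle `t = z₀/z₁` of `γ¹` is the cocycle `φ₀/φ₁` (Husemoller Ch. 17 §3: "Using (C₁)
  and the inclusion `ℂP¹ → ℂP^∞` …"; Milnor–Stasheff §14: `γ¹` restricts along
  `ℂP¹ ⊂ ℂPⁿ`).

Everything is proved; there are no named facts.

## References

* [HusemollerFibreBundles1994] D. Husemoller, *Fibre Bundles*, 3rd ed. (1994), Ch. 2 Prop. 5.5,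
  Ch. 3 §3 Prop. 3.2, Ch. 5 §3, Ch. 17 §3.
* [MilnorStasheffAMS76] J. Milnor, J. Stasheff, *Characteristic Classes* (1974), §14.
-/

noncomputable section

open Bundle Function Set Filter Topology Bornology
open scoped LinearAlgebra.Projectivization OnePoint

namespace Literature.AlgebraicTopology.CharacteristicClasses

/-! ### The tautological bundle, bundled -/

/-- **The tautological line bundle over `ℙ ℂ V`** as a `ComplexVectorBundle` (model fibre `ℂ`,
the bundle of `tautologicalLineCore ℂ V`; Milnor–Stasheff §14, `γ¹`). [cite: MilnorStasheffAMS76, §14] -/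
def tautologicalBundle (V : Type) [NormedAddCommGroup V] [NormedSpace ℂ V] :
    ComplexVectorBundle.{0, 0} (ℙ ℂ V) where
  F := ℂ
  E := (tautologicalLineCore ℂ V).Fiber

/-- The tautological bundle is a line bundle. [cite: MilnorStasheffAMS76, §14] -/
@[simp]
theorem rank_tautologicalBundle (V : Type) [NormedAddCommGroup V] [NormedSpace ℂ V] :
    (tautologicalBundle V).rank = 1 :=
  Module.finrank_self ℂ

/-! ### Isomorphism with a pull-back from a morphism of cores -/

namespace ComplexVectorBundle

variable {B₁ B₂ : Type} [TopologicalSpace B₁] [TopologicalSpace B₂] {F : Type}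
  [NormedAddCommGroup F] [NormedSpace ℂ F] [FiniteDimensional ℂ F] {ι₁ ι₂ : Type}

/-- The complex vector bundle of a core with finite-dimensional fibre. [folklore] -/
def ofCore (Z : VectorBundleCore ℂ B₁ F ι₁) : ComplexVectorBundle.{0, 0} B₁ where
  F := F
  E := Z.Fiber

/-- The rank of the bundle of a core is the dimension of its fibre. [folklore] -/
@[simp]
theorem rank_ofCore (Z : VectorBundleCore ℂ B₁ F ι₁) : (ofCore Z).rank = Module.finrank ℂ F := rfl

/-- **A morphism of cores gives an isomorphism with the induced bundle**: if the charts of `Z₁`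
over `B₁` map into charts of `Z₂` over `B₂` along `f` (`U¹ᵢ ⊆ f⁻¹ U²_{j i}`) and the cocycles
agree on overlaps (`g¹ᵢᵢ' = g²_{j i, j i'} ∘ f`), then `Z₁ ≅ f* Z₂` as bundles over `B₁`, by the
fibrewise equivalences `morphEquiv` (Husemoller, Ch. 5 §3: transition functions of induced
bundles; Ch. 3 Prop. 3.2: a fibrewise-isomorphic `f`-morphism is an isomorphism onto `f*`).
[cite: HusemollerFibreBundles1994, Ch. 5 §3 and Ch. 3 Prop. 3.2] -/
def isoPullbackOfCoreMorph (Z₁ : VectorBundleCore ℂ B₁ F ι₁) (Z₂ : VectorBundleCore ℂ B₂ F ι₂)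
    (f : C(B₁, B₂)) (j : ι₁ → ι₂) (hbase : ∀ i, Z₁.baseSet i ⊆ f ⁻¹' Z₂.baseSet (j i))
    (hcoord : ∀ i i' b, b ∈ Z₁.baseSet i ∩ Z₁.baseSet i' → ∀ v,
      Z₁.coordChange i i' b v = Z₂.coordChange (j i) (j i') (f b) v) :
    (ofCore Z₁).Iso ((ofCore Z₂).pullback f) where
  equiv b := Z₁.morphEquiv (Z₂ := Z₂) (f := f) (j := j) hbase b
  continuous_toFun := by
    refine (inducing_pullbackTotalSpaceEmbedding F Z₂.Fiber f).continuous_iff.2 ?_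
    exact (FiberBundle.continuous_proj F Z₁.Fiber).prodMk
      (Z₁.continuous_morph f.continuous hbase hcoord)
  continuous_invFun := Z₁.continuous_morphInv_pullback f hbase hcoord

end ComplexVectorBundle

/-! ### Projective lines -/

section ProjectiveLine

variable {V : Type} [NormedAddCommGroup V] [NormedSpace ℂ V] (e₀ e₁ : V) (φ₀ φ₁ : StrongDual ℂ V)
  (h₀₀ : φ₀ e₀ = 1) (h₀₁ : φ₀ e₁ = 0) (h₁₀ : φ₁ e₀ = 0) (h₁₁ : φ₁ e₁ = 1)

/-- The affine points of the line: `t e₀ + e₁` (homogeneous coordinates `[t : 1]`). [folklore] -/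
def lineVec (t : ℂ) : V := t • e₀ + e₁

include h₁₀ h₁₁ in
/-- `φ₁ (t e₀ + e₁) = 1`. [folklore] -/
@[simp]
theorem apply_lineVec_one (t : ℂ) : φ₁ (lineVec e₀ e₁ t) = 1 := by
  simp [lineVec, h₁₀, h₁₁]

include h₀₀ h₀₁ in
/-- `φ₀ (t e₀ + e₁) = t`. [folklore] -/
@[simp]
theorem apply_lineVec_zero (t : ℂ) : φ₀ (lineVec e₀ e₁ t) = t := by
  simp [lineVec, h₀₀, h₀₁]

include h₁₀ h₁₁ in
/-- `t e₀ + e₁ ≠ 0`. [folklore] -/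
theorem lineVec_ne_zero (t : ℂ) : lineVec e₀ e₁ t ≠ 0 := fun h ↦ by
  simpa [h] using apply_lineVec_one e₀ e₁ φ₁ h₁₀ h₁₁ t

include h₀₀ in
/-- `e₀ ≠ 0`. [folklore] -/
theorem ne_zero_of_dual : e₀ ≠ 0 := fun h ↦ by simp [h] at h₀₀

include h₀₀ h₀₁ h₁₀ h₁₁ in
/-- `[t e₀ + e₁] → [e₀]` as `t → ∞`: indeed `[t e₀ + e₁] = [e₀ + t⁻¹ e₁]` for `t ≠ 0`, and
`t⁻¹ → 0`. [folklore] -/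
theorem tendsto_mk_lineVec :
    Tendsto (fun t : ℂ ↦ Projectivization.mk ℂ (lineVec e₀ e₁ t) (lineVec_ne_zero e₀ e₁ φ₁ h₁₀ h₁₁ t))
      (coclosedCompact ℂ) (𝓝 (Projectivization.mk ℂ e₀ (ne_zero_of_dual e₀ φ₀ h₀₀))) := by
  have hne : ∀ s : ℂ, e₀ + s • e₁ ≠ 0 := fun s h ↦ by
    have := congrArg φ₀ h
    simp [h₀₀, h₀₁] at this
  have hg : ContinuousAt (fun s : ℂ ↦ Projectivization.mk ℂ (e₀ + s • e₁) (hne s)) 0 :=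
    ((continuous_const.add (continuous_id.smul continuous_const)).projectivizationMk hne).continuousAt
  have h0 : Projectivization.mk ℂ (e₀ + (0 : ℂ) • e₁) (hne 0) =
      Projectivization.mk ℂ e₀ (ne_zero_of_dual e₀ φ₀ h₀₀) := by
    congr 1
    rw [zero_smul, add_zero]
  rw [Filter.coclosedCompact_eq_cocompact, ← Metric.cobounded_eq_cocompact]
  have hlim : Tendsto (fun t : ℂ ↦ Projectivization.mk ℂ (e₀ + t⁻¹ • e₁) (hne t⁻¹)) (cobounded ℂ)
      (𝓝 (Projectivization.mk ℂ e₀ (ne_zero_of_dual e₀ φ₀ h₀₀))) := by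
    rw [← h0]
    exact hg.tendsto.comp tendsto_inv₀_cobounded
  refine hlim.congr' ?_
  filter_upwards [show ({0}ᶜ : Set ℂ) ∈ cobounded ℂ from isBounded_singleton] with t ht
  rw [mem_compl_iff, mem_singleton_iff] at ht
  rw [Projectivization.mk_eq_mk_iff]
  refine ⟨Units.mk0 t⁻¹ (inv_ne_zero ht), ?_⟩
  rw [Units.smul_def, Units.val_mk0, lineVec, smul_add, smul_smul, inv_mul_cancel₀ ht, one_smul]

include h₀₀ h₀₁ h₁₀ h₁₁ in
/-- **The projective line through `[e₀]` and `[e₁]`**, parametrised by the tree's `ℂP¹ =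
OnePoint ℂ` (`t ↔ [t : 1] ↦ [t e₀ + e₁]`, `∞ ↔ [1 : 0] ↦ [e₀]`), a continuous map
`OnePoint ℂ → ℙ ℂ V` (Husemoller, Ch. 17 §3: the inclusion `ℂP¹ → ℂP^∞`).
[cite: HusemollerFibreBundles1994, Ch. 17 §3] -/
def projectiveLine : C(OnePoint ℂ, ℙ ℂ V) :=
  OnePoint.continuousMapMk
    ⟨fun t ↦ Projectivization.mk ℂ (lineVec e₀ e₁ t) (lineVec_ne_zero e₀ e₁ φ₁ h₁₀ h₁₁ t),
      (continuous_lineVec_aux e₀ e₁).projectivizationMk _⟩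
    (Projectivization.mk ℂ e₀ (ne_zero_of_dual e₀ φ₀ h₀₀))
    (tendsto_mk_lineVec e₀ e₁ φ₀ φ₁ h₀₀ h₀₁ h₁₀ h₁₁)
where
  /-- `t ↦ t e₀ + e₁` is continuous. [folklore] -/
  continuous_lineVec_aux (e₀ e₁ : V) : Continuous (lineVec e₀ e₁) :=
    (continuous_id.smul continuous_const).add continuous_const

/-- The projective line at a finite point `t ↔ [t : 1]` is `[t e₀ + e₁]`. [folklore] -/
@[simp]
theorem projectiveLine_coe (t : ℂ) :
    projectiveLine e₀ e₁ φ₀ φ₁ h₀₀ h₀₁ h₁₀ h₁₁ t =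
      Projectivization.mk ℂ (lineVec e₀ e₁ t) (lineVec_ne_zero e₀ e₁ φ₁ h₁₀ h₁₁ t) :=
  rfl

/-- The projective line at `∞ ↔ [1 : 0]` is `[e₀]`. [folklore] -/
@[simp]
theorem projectiveLine_infty :
    projectiveLine e₀ e₁ φ₀ φ₁ h₀₀ h₀₁ h₁₀ h₁₁ ∞ =
      Projectivization.mk ℂ e₀ (ne_zero_of_dual e₀ φ₀ h₀₀) :=
  rfl

/-- The charts of `γ¹` over `OnePoint ℂ` as charts of the tautological bundle of `ℙ ℂ V`: the
affine chart `finite = {[t : 1]}` (coordinate `v₁`) is `U_{φ₁}`, the chart at infinity (coordinate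
`v₀`) is `U_{φ₀}`. [folklore] -/
def lineChartFunctional : ProjectiveLineChart → StrongDual ℂ V
  | .finite => φ₁
  | .infinite => φ₀

/-- **`γ¹ ≅ ι* γ_V`**: the tree's tautological line bundle over `ℂP¹ = OnePoint ℂ`
(`tautologicalLineBundle`, cocycle `t = z₀/z₁` from the affine chart to the chart at infinity) is
isomorphic to the pull-back of the tautological bundle of `ℙ ℂ V` along the projective line
through `[e₀]`, `[e₁]` — a morphism of cores: the chart `finite` maps into `U_{φ₁}`, `infinite`
into `U_{φ₀}`, and the cocycles agree, `t = φ₀(t e₀ + e₁) / φ₁(t e₀ + e₁)`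
(Milnor–Stasheff §14: `γ¹` is the restriction of the canonical bundle along `ℂP¹ ⊂ ℂPⁿ`;
Husemoller Ch. 17 §3: (C₃) ⇔ (C₃') "using (C₁) and the inclusion `ℂP¹ → ℂP^∞`").
[cite: MilnorStasheffAMS76, §14] [cite: HusemollerFibreBundles1994, Ch. 17 §3] -/
def tautologicalLineBundleIsoPullback :
    tautologicalLineBundle.Iso
      ((tautologicalBundle V).pullback (projectiveLine e₀ e₁ φ₀ φ₁ h₀₀ h₀₁ h₁₀ h₁₁)) :=
  ComplexVectorBundle.isoPullbackOfCoreMorph tautologicalCore (tautologicalLineCore ℂ V)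
    (projectiveLine e₀ e₁ φ₀ φ₁ h₀₀ h₀₁ h₁₀ h₁₁) (lineChartFunctional φ₀ φ₁)
    (by
      rintro (_ | _) x hx
      · obtain ⟨t, rfl⟩ := hx
        change Projectivization.mk ℂ _ _ ∈ (tautologicalLineCore ℂ V).baseSet φ₁
        rw [mk_mem_tautologicalLineCore_baseSet_iff, apply_lineVec_one e₀ e₁ φ₁ h₁₀ h₁₁]
        exact one_ne_zero
      · induction x using OnePoint.rec with
        | infty =>
          change Projectivization.mk ℂ _ _ ∈ (tautologicalLineCore ℂ V).baseSet φ₀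
          rw [mk_mem_tautologicalLineCore_baseSet_iff, h₀₀]
          exact one_ne_zero
        | coe t =>
          change Projectivization.mk ℂ _ _ ∈ (tautologicalLineCore ℂ V).baseSet φ₀
          rw [mk_mem_tautologicalLineCore_baseSet_iff, apply_lineVec_zero e₀ e₁ φ₀ h₀₀ h₀₁]
          exact ProjectiveLineChart.coe_mem_baseSet_infinite_iff.1 hx)
    (by
      rintro i i' x ⟨hi, hi'⟩ v
      have lhs : tautologicalCore.coordChange i i' x v = ProjectiveLineChart.transition i i' x * v := by
        simp [tautologicalCore]
      rw [lhs]
      induction x using OnePoint.rec with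
      | infty =>
        cases i
        · exact (ProjectiveLineChart.infty_not_mem_baseSet_finite hi).elim
        cases i'
        · exact (ProjectiveLineChart.infty_not_mem_baseSet_finite hi').elim
        rw [projectiveLine_infty, tautologicalLineCore_coordChange_apply]
        simp [lineChartFunctional, h₀₀]
      | coe t =>
        have ht : (t : OnePoint ℂ) ∈ ProjectiveLineChart.baseSet .infinite → t ≠ 0 :=
          ProjectiveLineChart.coe_mem_baseSet_infinite_iff.1
        rw [projectiveLine_coe, tautologicalLineCore_coordChange_apply]
        cases i <;> cases i'
        · simp [lineChartFunctional, apply_lineVec_one e₀ e₁ φ₁ h₁₀ h₁₁]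
        · simp [lineChartFunctional, apply_lineVec_one e₀ e₁ φ₁ h₁₀ h₁₁,
            apply_lineVec_zero e₀ e₁ φ₀ h₀₀ h₀₁]
        · simp [lineChartFunctional, apply_lineVec_one e₀ e₁ φ₁ h₁₀ h₁₁,
            apply_lineVec_zero e₀ e₁ φ₀ h₀₀ h₀₁]
        · simp [lineChartFunctional, apply_lineVec_zero e₀ e₁ φ₀ h₀₀ h₀₁, div_self (ht hi)])

end ProjectiveLine

end Literature.AlgebraicTopology.CharacteristicClasses
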